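import Literature.NumberTheory.GaloisRepresentations.ResidualRepresentation
import Literature.NumberTheory.GaloisRepresentations.AbsolutelyIrreducibleReduction
import Literature.NumberTheory.GaloisRepresentations.AbsGaloisGroupCompact
import Literature.NumberTheory.GaloisRepresentations.GaloisRep
import Mathlib.NumberTheory.Padics.Complex
import Mathlib.FieldTheory.IsAlgClosed.Basic
import Mathlib.Algebra.Order.Archimedean.Basic
import Mathlib.Topology.Order.Compact
import HarnessLib

/-!
# Route `PhantomRMYoshida`, crux `ResiduallyYoshidaLifting` (stmt-Langlands-13639), line
# `endoscopic-crossing-euler`: Stub 2d, the `ϖ`-trick (`stub_splitFrame`)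

Registered stub `stub_splitFrame` of the checked skeleton
`Cruxes/ResiduallyYoshidaLifting/Lines/endoscopic-crossing-euler.lean` (second lead), namespace
`Summit.Langlands.Langlands.Cruxes.ResiduallyYoshidaLifting.EndoscopicCrossingEuler`, PROVED.

**Statement.** `r : Γ_ℚ → GL₄(ℚ̄_p)` continuous (`ℚ̄_p = PadicAlgCl p`), `rint = P⁻¹ r P` an
integral model over `ℤ̄_p = 𝒪[ℚ̄_p] = Valued.integer (PadicAlgCl p)`, and a residual change of
basis `w ∈ GL₄(κ)` (`κ = ℤ̄_p/𝔪`) with `w⁻¹ (rint g mod 𝔪) w = (a g, b g; 0, d g)` block upper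
triangular (`2 × 2` blocks along `finSumFinEquiv`).  Then some conjugate `rint' = P'⁻¹ r P'` is
again integral with block DIAGONAL reduction `(a g, 0; 0, d g)`.

**Proof** (elementary replacement of the self-dual-lattice argument; Serre, *Abelian `ℓ`-adic
representations*, I §1.1 Remark 1 for integral models).
1. Lift `w` to `W ∈ GL₄(ℤ̄_p)` (entrywise lift; `det` is a unit iff its residue is non-zero,
   `exists_map_residue_eq`) and pass to `W⁻¹ rint W`, reducing to `w = 1`
   (`splitFrame_of_blockTriangular`).
2. The lower-left block `c(g)` of `rint g` has entries in `𝔪 = {‖x‖ < 1}`; by continuity of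
   `g ↦ P⁻¹ r(g) P` and compactness of `Γ_ℚ`, `t = sup ‖c(g)ᵢⱼ‖ < 1`.
3. `ℚ̄_p` is algebraically closed: `ϖ = p^{1/N}` with `t ≤ ‖ϖ‖² < 1` exists
   (`exists_sq_norm_ge`).
4. Conjugating by `D = diag(1,1,ϖ,ϖ)` gives entries `(a, ϖ b; ϖ⁻¹ c, d)`, still in `ℤ̄_p`
   (`‖ϖ⁻¹ c‖ ≤ t/‖ϖ‖ ≤ ‖ϖ‖ < 1`), with reduction `(a, 0; 0, d)`; the `GL₄(ℤ̄_p)`-valued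
   homomorphism is assembled by `exists_monoidHom_map_eq` (`ResidualRepresentation.lean`).

References: J.-P. Serre, *Abelian ℓ-adic representations and elliptic curves* (1968), Ch. I §1.1;
J. Bellaïche, G. Chenevier, *Families of Galois representations and Selmer groups*, Astérisque 324
(2009), §1.5.
-/

noncomputable section

open scoped MatrixGroups

open Matrix IsLocalRing

-- `Summit.Langlands.Langlands.…` (summit = sub-problem name, D-0017 layout) trips `dupNamespace`
-- on every decl (same as the landed `PhantomRMYoshidaResiduallyYoshidaLiftingDefs.lean`).
set_option linter.dupNamespace false
set_option autoImplicit false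

namespace Summit.Langlands.Langlands.Cruxes.ResiduallyYoshidaLifting.EndoscopicCrossingEuler

open Literature.NumberTheory.GaloisRepresentations

section Helpers

variable {p : ℕ} [Fact p.Prime]

/-- `𝒪[ℚ̄_p] = {‖x‖ ≤ 1}` (`Valued.v x = ‖x‖₊`). [folklore] -/
theorem mem_integer_iff_norm_le_one (x : PadicAlgCl p) :
    x ∈ Valued.integer (PadicAlgCl p) ↔ ‖x‖ ≤ 1 :=
  padicAlgCl_mem_valuationSubring_iff p x

/-- The maximal ideal of `𝒪[ℚ̄_p]` is the open unit ball `{‖x‖ < 1}`. [folklore] -/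
theorem mem_maximalIdeal_integer_iff (x : Valued.integer (PadicAlgCl p)) :
    x ∈ maximalIdeal (Valued.integer (PadicAlgCl p)) ↔ ‖(x : PadicAlgCl p)‖ < 1 :=
  mem_maximalIdeal_iff_norm_lt_one (O := (Valued.v (R := PadicAlgCl p)).valuationSubring)
    (padicAlgCl_mem_valuationSubring_iff p) x

/-- An element of `𝒪[ℚ̄_p]` reduces to `0` modulo `𝔪` iff it has norm `< 1`. [folklore] -/
theorem residue_eq_zero_iff_norm_lt_one (x : Valued.integer (PadicAlgCl p)) :
    residue (Valued.integer (PadicAlgCl p)) x = 0 ↔ ‖(x : PadicAlgCl p)‖ < 1 := by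
  rw [residue_eq_zero_iff, mem_maximalIdeal_integer_iff]

/-- `ℚ̄_p` contains elements of norm arbitrarily close to `1` from below: for `0 ≤ t < 1` there
is `ϖ ≠ 0` with `t ≤ ‖ϖ‖² < 1` (take `ϖ = p^{1/N}`, `ℚ̄_p` being algebraically closed).
[folklore] -/
theorem exists_sq_norm_ge {t : ℝ} (h0 : 0 ≤ t) (h1 : t < 1) :
    ∃ ϖ : PadicAlgCl p, ϖ ≠ 0 ∧ ‖ϖ‖ < 1 ∧ t ≤ ‖ϖ‖ ^ 2 := by
  have hp0 : (p : PadicAlgCl p) ≠ 0 := Nat.cast_ne_zero.mpr (Fact.out : p.Prime).ne_zero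
  have hq0 : 0 < ‖(p : PadicAlgCl p)‖ := norm_pos_iff.mpr hp0
  have hq1 : ‖(p : PadicAlgCl p)‖ < 1 := by
    rw [← PadicAlgCl.valuation_coe, PadicAlgCl.valuation_p, one_div, NNReal.coe_inv,
      NNReal.coe_natCast]
    exact inv_lt_one_of_one_lt₀ (by exact_mod_cast (Fact.out : p.Prime).one_lt)
  obtain ⟨n, hn⟩ := exists_pow_lt_of_lt_one (pow_pos hq0 2) h1
  obtain ⟨z, hz⟩ := IsAlgClosed.exists_pow_nat_eq (p : PadicAlgCl p) (Nat.succ_pos n)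
  have hzn : ‖z‖ ^ (n + 1) = ‖(p : PadicAlgCl p)‖ := by rw [← norm_pow, hz]
  refine ⟨z, ?_, ?_, ?_⟩
  · rintro rfl
    rw [zero_pow (Nat.succ_ne_zero n)] at hz
    exact hp0 hz.symm
  · exact (pow_lt_one_iff_of_nonneg (norm_nonneg z) (Nat.succ_ne_zero n)).mp (hzn ▸ hq1)
  · have h : t ^ (n + 1) ≤ (‖z‖ ^ 2) ^ (n + 1) := by
      rw [← pow_mul, mul_comm, pow_mul, hzn]
      calc t ^ (n + 1) ≤ t ^ n := pow_le_pow_of_le_one h0 h1.le (Nat.le_succ n)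
        _ ≤ ‖(p : PadicAlgCl p)‖ ^ 2 := hn.le
    exact (pow_le_pow_iff_left₀ h0 (by positivity) (Nat.succ_ne_zero n)).mp h

/-- Finitely many continuous functions `< 1` on a compact space are uniformly bounded by some
`t < 1` (extreme value theorem). [folklore] -/
theorem exists_forall_le_of_forall_lt_one {Γ : Type*} [TopologicalSpace Γ] [CompactSpace Γ]
    [Nonempty Γ] {ι : Type*} [Finite ι] [Nonempty ι] (f : ι → Γ → ℝ)
    (hf : ∀ i, Continuous (f i)) (h1 : ∀ i g, f i g < 1) :
    ∃ t : ℝ, t < 1 ∧ ∀ i g, f i g ≤ t := by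
  have hmax : ∀ i, ∃ g₀, ∀ g, f i g ≤ f i g₀ := fun i => by
    obtain ⟨g₀, -, hg₀⟩ :=
      isCompact_univ.exists_isMaxOn Set.univ_nonempty (hf i).continuousOn
    exact ⟨g₀, fun g => (isMaxOn_iff.mp hg₀) g (Set.mem_univ g)⟩
  choose g₀ hg₀ using hmax
  obtain ⟨i₀, hi₀⟩ := Finite.exists_max fun i => f i (g₀ i)
  exact ⟨f i₀ (g₀ i₀), h1 _ _, fun i g => (hg₀ i g).trans (hi₀ i)⟩

/-- Over a local ring `R`, every invertible matrix over the residue field lifts to an invertible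
matrix over `R` (lift the entries; the determinant is a unit since its residue is). [folklore] -/
theorem exists_map_residue_eq {R : Type*} [CommRing R] [IsLocalRing R] {n : Type*} [Fintype n]
    [DecidableEq n] (w : GL n (ResidueField R)) :
    ∃ W : GL n R, Matrix.GeneralLinearGroup.map (residue R) W = w := by
  choose f hf using (residue_surjective (R := R))
  let W₀ : Matrix n n R := (w : Matrix n n (ResidueField R)).map f
  have hW₀ : W₀.map (residue R) = w := by
    ext i j
    exact hf _
  have hdet : IsUnit W₀.det := by
    rw [← residue_ne_zero_iff_isUnit, RingHom.map_det, RingHom.mapMatrix_apply, hW₀]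
    exact ((Matrix.isUnit_iff_isUnit_det _).mp w.isUnit).ne_zero
  refine ⟨Matrix.GeneralLinearGroup.mk'' W₀ hdet, Units.ext ?_⟩
  exact hW₀

end Helpers

/-! ### The `ϖ`-trick for an integral model with block upper triangular reduction -/

section Main

variable {p : ℕ} [Fact p.Prime]

/-- **The `ϖ`-trick** (case `w = 1`): an integral model `rint = P⁻¹ r P` over `ℤ̄_p` of a
continuous `r : Γ_ℚ → GL₄(ℚ̄_p)` whose reduction is block upper triangular `(a, b; 0, d)` is
conjugate, by `D = diag(1,1,ϖ,ϖ)` with `sup_g ‖c(g)‖ ≤ ‖ϖ‖² < 1`, to an integral model with block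
diagonal reduction `(a, 0; 0, d)`. [cite: SerreAbelianLadic1968, Ch. I §1.1 Remark 1] -/
theorem splitFrame_of_blockTriangular
    (r : Literature.NumberTheory.GaloisRepresentations.FramedGaloisRep ℚ (PadicAlgCl p) 4)
    (P : GL (Fin 4) (PadicAlgCl p))
    (rint : Field.absoluteGaloisGroup ℚ →* GL (Fin 4) (Valued.integer (PadicAlgCl p)))
    (a b d : Field.absoluteGaloisGroup ℚ →
      Matrix (Fin 2) (Fin 2) (IsLocalRing.ResidueField (Valued.integer (PadicAlgCl p))))
    (hrint : ∀ g, Matrix.GeneralLinearGroup.map (Valued.integer (PadicAlgCl p)).subtype (rint g) =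
      P⁻¹ * r g * P)
    (hred : ∀ g, (Matrix.GeneralLinearGroup.map
        (IsLocalRing.residue (Valued.integer (PadicAlgCl p))) (rint g)).val =
        Matrix.reindex finSumFinEquiv finSumFinEquiv (Matrix.fromBlocks (a g) (b g) 0 (d g))) :
    ∃ (P' : GL (Fin 4) (PadicAlgCl p))
      (rint' : Field.absoluteGaloisGroup ℚ →* GL (Fin 4) (Valued.integer (PadicAlgCl p))),
      (∀ g, Matrix.GeneralLinearGroup.map (Valued.integer (PadicAlgCl p)).subtype (rint' g) =
        P'⁻¹ * r g * P') ∧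
      (∀ g, (Matrix.GeneralLinearGroup.map
          (IsLocalRing.residue (Valued.integer (PadicAlgCl p))) (rint' g)).val =
        Matrix.reindex finSumFinEquiv finSumFinEquiv (Matrix.fromBlocks (a g) 0 0 (d g))) := by
  set e := (finSumFinEquiv : Fin 2 ⊕ Fin 2 ≃ Fin 4)
  -- (1) entries of `rint g`, seen in `ℚ̄_p`, are the entries of `P⁻¹ r(g) P`, of norm `≤ 1`
  have hcoe : ∀ g k l, ((P⁻¹ * r g * P : GL (Fin 4) (PadicAlgCl p)) :
      Matrix (Fin 4) (Fin 4) (PadicAlgCl p)) k l =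
        (((rint g : GL (Fin 4) (Valued.integer (PadicAlgCl p))) :
          Matrix (Fin 4) (Fin 4) (Valued.integer (PadicAlgCl p))) k l : PadicAlgCl p) :=
    fun g k l => by rw [← hrint g]; rfl
  have hle : ∀ g k l, ‖((((rint g : GL (Fin 4) (Valued.integer (PadicAlgCl p))) :
      Matrix (Fin 4) (Fin 4) (Valued.integer (PadicAlgCl p))) k l : PadicAlgCl p))‖ ≤ 1 :=
    fun g k l => (mem_integer_iff_norm_le_one _).1 (SetLike.coe_mem _)
  -- (2) residues of the entries: block upper triangular
  have hres : ∀ g x y, residue (Valued.integer (PadicAlgCl p))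
      (((rint g : GL (Fin 4) (Valued.integer (PadicAlgCl p))) :
        Matrix (Fin 4) (Fin 4) (Valued.integer (PadicAlgCl p))) (e x) (e y)) =
        Matrix.fromBlocks (a g) (b g) 0 (d g) x y := by
    intro g x y
    have h := congrFun (congrFun (hred g) (e x)) (e y)
    rw [reindex_apply, submatrix_apply, Equiv.symm_apply_apply, Equiv.symm_apply_apply] at h
    exact h
  have hc1 : ∀ g (i j : Fin 2), ‖((((rint g : GL (Fin 4) (Valued.integer (PadicAlgCl p))) :
      Matrix (Fin 4) (Fin 4) (Valued.integer (PadicAlgCl p))) (e (Sum.inr i)) (e (Sum.inl j)) :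
        PadicAlgCl p))‖ < 1 := by
    intro g i j
    rw [← residue_eq_zero_iff_norm_lt_one, hres, fromBlocks_apply₂₁, Matrix.zero_apply]
  -- (3) a uniform bound `t < 1` on the lower-left block (compactness of `Γ_ℚ`)
  obtain ⟨t, ht1, ht⟩ : ∃ t : ℝ, t < 1 ∧ ∀ g (i j : Fin 2),
      ‖((((rint g : GL (Fin 4) (Valued.integer (PadicAlgCl p))) :
        Matrix (Fin 4) (Fin 4) (Valued.integer (PadicAlgCl p))) (e (Sum.inr i)) (e (Sum.inl j)) :
          PadicAlgCl p))‖ ≤ t := by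
    have hcont : ∀ k l, Continuous fun g =>
        ‖((((rint g : GL (Fin 4) (Valued.integer (PadicAlgCl p))) :
          Matrix (Fin 4) (Fin 4) (Valued.integer (PadicAlgCl p))) k l : PadicAlgCl p))‖ := by
      intro k l
      simp_rw [← hcoe]
      exact ((Units.continuous_val.comp ((continuous_const.mul r.continuous_toFun).mul
        continuous_const)).matrix_elem k l).norm
    obtain ⟨t, ht1, ht⟩ :=
      exists_forall_le_of_forall_lt_one (Γ := Field.absoluteGaloisGroup ℚ)
      (fun (ij : Fin 2 × Fin 2) g =>
        ‖((((rint g : GL (Fin 4) (Valued.integer (PadicAlgCl p))) :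
          Matrix (Fin 4) (Fin 4) (Valued.integer (PadicAlgCl p))) (e (Sum.inr ij.1))
            (e (Sum.inl ij.2)) : PadicAlgCl p))‖)
      (fun ij => hcont _ _) (fun ij g => hc1 g ij.1 ij.2)
    exact ⟨t, ht1, fun g i j => ht (i, j) g⟩
  have ht0 : 0 ≤ t := (norm_nonneg _).trans (ht 1 0 0)
  -- (4) `ϖ` with `t ≤ ‖ϖ‖² < 1`
  obtain ⟨ϖ, hϖ0, hϖ1, htϖ⟩ := exists_sq_norm_ge (p := p) ht0 ht1
  have hϖpos : 0 < ‖ϖ‖ := norm_pos_iff.mpr hϖ0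
  -- (5) `D = diag(1,1,ϖ,ϖ)` and the conjugate `φ = (P D)⁻¹ r (P D)`
  let δ : Fin 4 → PadicAlgCl p := fun k =>
    Sum.elim (fun _ => (1 : PadicAlgCl p)) (fun _ => ϖ) (e.symm k)
  have hδl : ∀ i, δ (e (Sum.inl i)) = 1 := fun i => by simp [δ]
  have hδr : ∀ i, δ (e (Sum.inr i)) = ϖ := fun i => by simp [δ]
  have hδ : ∀ k, δ k ≠ 0 := by
    intro k
    obtain ⟨x, rfl⟩ := e.surjective k
    rcases x with i | i
    · rw [hδl]; exact one_ne_zero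
    · rw [hδr]; exact hϖ0
  let D : GL (Fin 4) (PadicAlgCl p) :=
    ⟨diagonal δ, diagonal fun k => (δ k)⁻¹,
      by rw [diagonal_mul_diagonal, ← diagonal_one]; congr 1; funext k
         exact mul_inv_cancel₀ (hδ k),
      by rw [diagonal_mul_diagonal, ← diagonal_one]; congr 1; funext k
         exact inv_mul_cancel₀ (hδ k)⟩
  let φ : Field.absoluteGaloisGroup ℚ →* GL (Fin 4) (PadicAlgCl p) :=
    (MulAut.conj (P * D)⁻¹).toMonoidHom.comp r.toMonoidHom
  have hφ : ∀ g, φ g = (P * D)⁻¹ * r g * (P * D) := fun g => by simp [φ, mul_assoc]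
  have hφval : ∀ g k l,
      ((φ g : GL (Fin 4) (PadicAlgCl p)) : Matrix (Fin 4) (Fin 4) (PadicAlgCl p)) k l =
        (δ k)⁻¹ * (((rint g : GL (Fin 4) (Valued.integer (PadicAlgCl p))) :
        Matrix (Fin 4) (Fin 4) (Valued.integer (PadicAlgCl p))) k l : PadicAlgCl p) * δ l := by
    intro g k l
    have h1 : φ g = D⁻¹ * (P⁻¹ * r g * P) * D := by
      rw [hφ, _root_.mul_inv_rev]; simp only [mul_assoc]
    rw [h1, ← hcoe, Units.val_mul, Units.val_mul]
    change ((diagonal fun k => (δ k)⁻¹) * ((P⁻¹ * r g * P : GL (Fin 4) (PadicAlgCl p)) :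
      Matrix (Fin 4) (Fin 4) (PadicAlgCl p)) * diagonal δ) k l = _
    rw [mul_diagonal, diagonal_mul]
  -- the four blocks of `φ g`
  have h11 : ∀ g (i j : Fin 2), ((φ g : GL (Fin 4) (PadicAlgCl p)) :
      Matrix (Fin 4) (Fin 4) (PadicAlgCl p)) (e (Sum.inl i)) (e (Sum.inl j)) =
        (((rint g : GL (Fin 4) (Valued.integer (PadicAlgCl p))) :
          Matrix (Fin 4) (Fin 4) (Valued.integer (PadicAlgCl p))) (e (Sum.inl i)) (e (Sum.inl j)) :
            PadicAlgCl p) := by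
    intro g i j
    rw [hφval, hδl, hδl, inv_one, one_mul, mul_one]
  have h22 : ∀ g (i j : Fin 2), ((φ g : GL (Fin 4) (PadicAlgCl p)) :
      Matrix (Fin 4) (Fin 4) (PadicAlgCl p)) (e (Sum.inr i)) (e (Sum.inr j)) =
        (((rint g : GL (Fin 4) (Valued.integer (PadicAlgCl p))) :
          Matrix (Fin 4) (Fin 4) (Valued.integer (PadicAlgCl p))) (e (Sum.inr i)) (e (Sum.inr j)) :
            PadicAlgCl p) := by
    intro g i j
    rw [hφval, hδr, hδr, inv_mul_eq_div, div_mul_cancel₀ _ hϖ0]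
  have h12 : ∀ g (i j : Fin 2), ‖((φ g : GL (Fin 4) (PadicAlgCl p)) :
      Matrix (Fin 4) (Fin 4) (PadicAlgCl p)) (e (Sum.inl i)) (e (Sum.inr j))‖ < 1 := by
    intro g i j
    rw [hφval, hδl, hδr, inv_one, one_mul, norm_mul]
    exact lt_of_le_of_lt (mul_le_of_le_one_left (norm_nonneg _) (hle g _ _)) hϖ1
  have h21 : ∀ g (i j : Fin 2), ‖((φ g : GL (Fin 4) (PadicAlgCl p)) :
      Matrix (Fin 4) (Fin 4) (PadicAlgCl p)) (e (Sum.inr i)) (e (Sum.inl j))‖ < 1 := by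
    intro g i j
    rw [hφval, hδr, hδl, mul_one, norm_mul, norm_inv, inv_mul_lt_iff₀ hϖpos, mul_one]
    calc _ ≤ t := ht g i j
      _ ≤ ‖ϖ‖ ^ 2 := htϖ
      _ < ‖ϖ‖ := by rw [sq]; exact mul_lt_of_lt_one_left hϖpos hϖ1
  -- the entries of `φ g` are integral
  have hint : ∀ g k l, ‖((φ g : GL (Fin 4) (PadicAlgCl p)) :
      Matrix (Fin 4) (Fin 4) (PadicAlgCl p)) k l‖ ≤ 1 := by
    intro g k l
    obtain ⟨x, rfl⟩ := e.surjective k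
    obtain ⟨y, rfl⟩ := e.surjective l
    rcases x with i | i <;> rcases y with j | j
    · rw [h11]; exact hle g _ _
    · exact (h12 g i j).le
    · exact (h21 g i j).le
    · rw [h22]; exact hle g _ _
  -- hence `φ` takes values in `GL₄(ℤ̄_p)` and lifts to `rint' : Γ_ℚ → GL₄(ℤ̄_p)`
  have hmem : ∀ g, φ g ∈ (Matrix.GeneralLinearGroup.map (n := Fin 4)
      (Valued.v (R := PadicAlgCl p)).valuationSubring.subtype).range := by
    intro g
    rw [mem_range_generalLinearGroup_map_iff]
    refine ⟨fun k l => (padicAlgCl_mem_valuationSubring_iff p _).2 (hint g k l),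
      fun k l => (padicAlgCl_mem_valuationSubring_iff p _).2 ?_⟩
    rw [← map_inv]
    exact hint g⁻¹ k l
  obtain ⟨rint', hrint'⟩ :
      ∃ rint' : Field.absoluteGaloisGroup ℚ →* GL (Fin 4) (Valued.integer (PadicAlgCl p)),
        ∀ g, Matrix.GeneralLinearGroup.map (Valued.integer (PadicAlgCl p)).subtype (rint' g) =
          φ g :=
    exists_monoidHom_map_eq φ hmem
  refine ⟨P * D, rint', fun g => (hrint' g).trans (hφ g), fun g => ?_⟩
  -- (6) the reduction of `rint' g` is block diagonal
  have hcoe' : ∀ k l, ((((rint' g : GL (Fin 4) (Valued.integer (PadicAlgCl p))) :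
      Matrix (Fin 4) (Fin 4) (Valued.integer (PadicAlgCl p))) k l : PadicAlgCl p)) =
        ((φ g : GL (Fin 4) (PadicAlgCl p)) : Matrix (Fin 4) (Fin 4) (PadicAlgCl p)) k l :=
    fun k l => by rw [← hrint' g]; rfl
  ext k l
  obtain ⟨x, rfl⟩ := e.surjective k
  obtain ⟨y, rfl⟩ := e.surjective l
  rw [reindex_apply, submatrix_apply, Equiv.symm_apply_apply, Equiv.symm_apply_apply]
  change residue (Valued.integer (PadicAlgCl p))
    (((rint' g : GL (Fin 4) (Valued.integer (PadicAlgCl p))) :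
      Matrix (Fin 4) (Fin 4) (Valued.integer (PadicAlgCl p))) (e x) (e y)) = _
  rcases x with i | i <;> rcases y with j | j
  · have hent : (((rint' g : GL (Fin 4) (Valued.integer (PadicAlgCl p))) :
        Matrix (Fin 4) (Fin 4) (Valued.integer (PadicAlgCl p))) (e (Sum.inl i)) (e (Sum.inl j))) =
          ((rint g : GL (Fin 4) (Valued.integer (PadicAlgCl p))) :
            Matrix (Fin 4) (Fin 4) (Valued.integer (PadicAlgCl p))) (e (Sum.inl i))
              (e (Sum.inl j)) :=
      Subtype.ext ((hcoe' _ _).trans (h11 g i j))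
    rw [hent, hres, fromBlocks_apply₁₁, fromBlocks_apply₁₁]
  · rw [fromBlocks_apply₁₂, Matrix.zero_apply, residue_eq_zero_iff_norm_lt_one, hcoe']
    exact h12 g i j
  · rw [fromBlocks_apply₂₁, Matrix.zero_apply, residue_eq_zero_iff_norm_lt_one, hcoe']
    exact h21 g i j
  · have hent : (((rint' g : GL (Fin 4) (Valued.integer (PadicAlgCl p))) :
        Matrix (Fin 4) (Fin 4) (Valued.integer (PadicAlgCl p))) (e (Sum.inr i)) (e (Sum.inr j))) =
          ((rint g : GL (Fin 4) (Valued.integer (PadicAlgCl p))) :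
            Matrix (Fin 4) (Fin 4) (Valued.integer (PadicAlgCl p))) (e (Sum.inr i))
              (e (Sum.inr j)) :=
      Subtype.ext ((hcoe' _ _).trans (h22 g i j))
    rw [hent, hres, fromBlocks_apply₂₂, fromBlocks_apply₂₂]

end Main

/-- **Stub 2d (the ϖ-trick: block-triangular reduction ⇒ block-diagonal reduction over `ℤ̄_p`).**  Let
`r : Γ_ℚ → GL₄(ℚ̄_p)` be continuous, `rint = P⁻¹ r P` an integral model over `ℤ̄_p = 𝒪_{ℚ̄_p}`, and suppose that after
a residual change of basis `w ∈ GL₄(κ)` (`κ = ℤ̄_p/𝔪`) the reduction of `rint` is block upper triangular,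
`w⁻¹ · (rint g mod 𝔪) · w = (a g, b g; 0, d g)`.  Then some conjugate `rint' = P'⁻¹ r P'` is again integral and has
block DIAGONAL reduction `(a g, 0; 0, d g)`.  Why true: lift `w` to `W ∈ GL₄(ℤ̄_p)` (entrywise lift; `det` is a unit
iff its residue is non-zero) and pass to `W⁻¹ rint W`, whose lower-left block `c(g)` has entries in `𝔪`; by
continuity of `g ↦ P⁻¹ r(g) P` and compactness of `Γ_ℚ`, `λ = sup_g ‖c(g)‖ < 1`; `ℚ̄_p` contains `ϖ = p^{1/N}` with
`λ ≤ ‖ϖ‖² < 1`, and conjugating by `D = diag(1,1,ϖ,ϖ)` gives `(a, ϖ b; ϖ⁻¹ c, d)`, still `ℤ̄_p`-valued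
(`‖ϖ⁻¹ c‖ ≤ λ/‖ϖ‖ ≤ ‖ϖ‖ < 1`) with reduction `(a, 0; 0, d)`; the `GL₄(ℤ̄_p)`-valued homomorphism is assembled with
`exists_monoidHom_map_eq`.  Size M/L (~300 lines).  (Over a discretely valued `𝒪_E` this is the passage to the
ramified quadratic extension `E(√π)`; over `ℤ̄_p` no extension is needed.) [cite: SerreAbelianLadic1968, Ch. I §1.1 Remark 1; BellaicheChenevier2009, §1.5] -/
theorem stub_splitFrame :
    ∀ (p : ℕ) [Fact p.Prime]
      (r : Literature.NumberTheory.GaloisRepresentations.FramedGaloisRep ℚ (PadicAlgCl p) 4)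
      (P : GL (Fin 4) (PadicAlgCl p))
      (rint : Field.absoluteGaloisGroup ℚ →* GL (Fin 4) (Valued.integer (PadicAlgCl p)))
      (w : GL (Fin 4) (IsLocalRing.ResidueField (Valued.integer (PadicAlgCl p))))
      (a b d : Field.absoluteGaloisGroup ℚ →
        Matrix (Fin 2) (Fin 2) (IsLocalRing.ResidueField (Valued.integer (PadicAlgCl p)))),
      (∀ g, Matrix.GeneralLinearGroup.map (Valued.integer (PadicAlgCl p)).subtype (rint g) = P⁻¹ * r g * P) →
      (∀ g, (w⁻¹ * Matrix.GeneralLinearGroup.map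
          (IsLocalRing.residue (Valued.integer (PadicAlgCl p))) (rint g) * w).val =
          Matrix.reindex finSumFinEquiv finSumFinEquiv (Matrix.fromBlocks (a g) (b g) 0 (d g))) →
      ∃ (P' : GL (Fin 4) (PadicAlgCl p))
        (rint' : Field.absoluteGaloisGroup ℚ →* GL (Fin 4) (Valued.integer (PadicAlgCl p))),
        (∀ g, Matrix.GeneralLinearGroup.map (Valued.integer (PadicAlgCl p)).subtype (rint' g) =
          P'⁻¹ * r g * P') ∧
        (∀ g, (Matrix.GeneralLinearGroup.map
            (IsLocalRing.residue (Valued.integer (PadicAlgCl p))) (rint' g)).val =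
          Matrix.reindex finSumFinEquiv finSumFinEquiv (Matrix.fromBlocks (a g) 0 0 (d g))) := by
  intro p _ r P rint w a b d hrint hw
  -- lift `w` to `W ∈ GL₄(ℤ̄_p)` and pass to `W⁻¹ rint W`
  obtain ⟨W, hW⟩ := exists_map_residue_eq w
  let rint₁ : Field.absoluteGaloisGroup ℚ →* GL (Fin 4) (Valued.integer (PadicAlgCl p)) :=
    (MulAut.conj W⁻¹).toMonoidHom.comp rint
  have hrint₁ : ∀ g, rint₁ g = W⁻¹ * rint g * W := fun g => by simp [rint₁]
  refine splitFrame_of_blockTriangular r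
    (P * Matrix.GeneralLinearGroup.map (Valued.integer (PadicAlgCl p)).subtype W) rint₁ a b d
    (fun g => ?_) (fun g => ?_)
  · rw [hrint₁]
    simp only [map_mul, map_inv, hrint, _root_.mul_inv_rev, mul_assoc]
  · rw [hrint₁, map_mul, map_mul, map_inv, hW]
    exact hw g

end Summit.Langlands.Langlands.Cruxes.ResiduallyYoshidaLifting.EndoscopicCrossingEuler
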